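import Literature.MathematicalPhysics.QuantumFieldTheory.Balaban1983to89.B9Prop26AtPinsOne
import Literature.MathematicalPhysics.QuantumFieldTheory.Balaban1983to89.B9Eq3132Ineq2142Covariant

/-!
# `Balaban1983to89.B9LettersHAtOneG0` — [B9] (3.126) ∕ (3.133) at the TRIVIAL BACKGROUND: the `G₀Q*`- and `∇_UG₀Q*`-letters of Theorem 3.12 ∕ 3.13's
# reduction (`LettersH.gQs2 ∕ dgQs`, `Letters313.gQs2`) HOLD AT `U = 1` at node00-def-Y's pinned letters, uniformly on the k-level census —
# [4] Prop. 2.6 (2.136) (N03's theorem of record) READ ONTO THE N06 PINS through dag-n06-d's coordinate functor, Lemma 2.1 (2.61) for `supp Q*ω`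

T. Bałaban, *Propagators for lattice gauge theories in a background field*, Commun. Math. Phys. **99** (1985) 389–434
[`Balaban1985BackgroundPropagators`, "B9"]; [4] = T. Bałaban, *Propagators and renormalization transformations for lattice gauge
theories. II*, Commun. Math. Phys. **96** (1984) 223–250 [`Balaban1984PropagatorsII`].

statement-level skeleton of published theorems with citation tags; proofs where landed; nothing here is a claim about the Yang–Mills
mass gap

THE PRINTED LOCI (verbatim).  [B9] p. 420: *"They imply the formula HB = GQ\*(QGQ\*)⁻¹B. (3.126)"*; p. 422 displays (3.133) — the bounds of
`|H_{μν}(x, y′)|`, `|∇H_{μν}(x, y′)|` and a Hölder entry by `O(1)[1, (Lʲη)⁻¹, …](L^{j′}η)^{−d}e^{−(1∕2)δ₁d(y,y′)}` — and derives it from (3.132) *"together with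
Theorem 3.3 for G"*; Thm 3.3 p. 399: *"the operator G(U) (a = 1) satisfies the inequalities (3.42)–(3.47)"*; p. 407,
the sentence before Cor. 3.5: *"There we have proved these theorems for operators with the external gauge field configuration U = 1."*  [4] Prop. 2.6
p. 247: *"|(GJ)(x)|, |(∇GJ)(x)|, |(G∇\*J)(x)|, |(ΔGJ)(x)| ≤ O(1)[(L^jη)², L^jη, L^jη, 1]e^{−δ₃d(y,y′)}|J| (2.136) for x ∈ Δ(y), y ∈ Λ_j,
supp J ⊂ Δ(y′)"*; Lemma 2.1 (2.61) p. 234: *"sup_y Σ_{y′∈𝔅} e^{−αδ₀d(y,y′)} ≤ c₁(α)"*.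

THE POINT.  The rows-20–21 binders of the N06 certificate (dag-n06-d, editions 16–17 `…N06AtOpsYNuOfRecordV6EPairMW ∕ MX`) display
`hlettersH12 : … → B9Thm312WholeH.LettersH (𝔬12 x) 1 (H x) … B12₃ δ12₃ U` (dag-n06-l), whose fields `gQs2 ∕ dgQs` ask for majorants `B₃e^{−δ₃d}` of
`G₀Q* : 𝔠_Z⁽⁰⁾ → 𝔠⁽²⁾` and `∇_UG₀Q* : 𝔠_Z⁽⁰⁾ → 𝔠_Y⁽¹⁾` over the letter record `𝔬12 x`, pinned (`hG0co12 ∕ hQsco12 ∕ hDco12`, `hblk12 ∕ hblkY12 ∕ hblkZ12`) to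
node00-def-Y's coordinate models `GcoK … .GA ∕ QscoKH … parBY ∕ DcoK` over dag-n06-d's carriers `XBK ∕ XHK` with the block map `blkBK (bI x)` (`hlev ∕ hβ1`).
AT `U = 1` the letter `G_A(1)` IS r03's `G = Δ_a⁻¹` lifted (`Node00.OpsYDeltaA.GAY_one_liftY`), `Q*(1)` is the lift of the flat kernel `qsK` (`QsY_one`),
`∇_{1,ν}` the lift of `DV ν` (dag-n06-g `cdB_one_liftY`) — so these two fields ARE [4] Prop. 2.6 (2.136)₀,₁ for `G`, a TREE THEOREM on the genuine
k-level census (dag-n03-a `B6Prop26PrintedKLevelFinalV1.prop26Printed_kLevel`, hypothesis-free), read through the coordinate functor.  The companion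
`B9Prop26AtPinsOne` (§1–§4 there) reads (2.136) onto the pinned models with the TORUS block map and proves that dag-n06-d's coordinate functor acts slice by
slice on lifted families.  THIS FILE finishes the reading in the certificate's currencies: §5 RE-BLOCKING THROUGH `Q*♭`: `supp Q*♭ω` spreads over the blocks met by the double block of the index bond (within
`ℓ + 3`, dag-n06-i `B9Eq3132Ineq2142Covariant`), summed by (2.61) at a quarter of the rate (p21's `consts_260_261`), and the certificate's block map `bI`
costs one unit of distance — a majorant `C·c·e^{¾δ(ℓ+4)}·(Lʲη)(a)ᵐ·e^{−¾δd(a,a′)}` in the geometry `geo9K` of index bonds; §6 ★ `hasMaj_G0_Qstar_one`,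
★ `hasMaj_D_G0_Qstar_one` — the two fields at ANY letter record so pinned, in the state classes `cNorm` (the reading constants `c·c⁻¹` cancel); §7 ★★
`lettersH_G0_one_kIdx` — uniformly on the census: one threshold, one `B₃`, one `δ₃` for every member and every such record.

HONEST SCOPE.  A READING file: the analytic input is N03's Prop. 2.6 and p21's Lemma 2.1, both tree theorems cited by name; the pins, carriers and
functor are dag-n06-d's, the letters node00-def-Y's, the schemas dag-n06-l's; nothing of [B9] at curved `U` is asserted.  What this gives the
certificate: the `gQs2 ∕ dgQs` halves of the displayed `hlettersH12` body (and `Letters313.gQs2` of `hletters13`) are inhabited at `U ↦ 1` with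
member-uniform constants — an A6 partial witness (referee ref-A's WATCH-JSAT-N06, rows 20–21); the `c2 ∕ c12` halves (`(QGQ*)⁻¹`: [4] Prop. 2.7 (2.149),
`B6Prop27PrintedKLevelV1.prop27Printed_kLevel`) are the sequel's.  COUNT-NEUTRAL; N06 is NOT discharged; one finite lattice at a time; nothing continuum,
nothing about the mass gap.  Cell `pub-ymgap` (HUMAN RULING D-0062), Track A node N06 [B9], bundle F3 (the `U = 1` obligations, Cor. 3.5 ∕ [4]), seat
`pub-ymgap-dag-n06-h` (g19), 2026-08-27.
-/

noncomputable section

namespace Literature.MathematicalPhysics.QuantumFieldTheory.Balaban1983to89.B9LettersHAtOneG0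

open B6MultiLevelBoxOperator (N0)
open B6MultiLevelTorusOperator (TDomains)
open B6Geom246MultiLevelBox (bset)
open B6Geom246MultiLevelTorus (geomT)
open B6GlobalChartV1 (PV blkV1)
open B6KLevelCensusIndexV1 (KIdx kGeo kGeoG)
open B6GradLegKLevelV1 (DV)
open B6LapLegKLevelV1 (DVa LapV)
open B6Prop26Census2136KLevelV1 (Gop supIn kG)
open B6RandomWalk (HasMajorant BlockSupp)
open B6RandomWalkHom (HasMajorantHom)
open B6 (pref4)
open B9Ineq347GAAtLetters (hasMajorant_of_census2136 abs_le_supIn)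
open B9Cor35ComparisonsGAAtLetters (cdB_one_liftY cdsB_one_liftY lapB_one_liftY)
open B9Thm39ReadingCoords (cR39 cR39_nonneg)
open B9CoReadingCoords B9CoReadingCoordsH B9Prop26AtPinsOne
open Node00 Node00.OpsYSectDCoords
open B9Thm314GpFlatResolvent (abs_le_sum_of_hasMajorant)
open B9Thm314GpFlatMultiLevelTorus (consts_260_261)
open B6Lemma21Repaired (Ineq261With)
open B6Ineq2142KLevelV1 (lvl β qwt qwt_le qwt_nonneg metBlocks mem_metBlocks geomT_dist_ends_le)
open B9Eq3132Ineq2142Covariant (qK_apply blkV1_mem_metBlocks two_le_RMh ends_of_qwt_ne_zero)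
open B9GeoNormsKLevelV1 (geo9K)
open B9GeoLemma21KLevelV1 (one_le_Mh one_le_P one_le_k geo9K_len_pos)
open B9Ineq349SiteComposite (distB distB_nonneg)
open B9Ineq349SiteFromBlocks (distB_triangle)
open B6Ineq288MultiLevelTorus (dist_symm_geoBT)
open B9Thm34Ext (toB6)
open scoped Matrix

variable {d ℓ : ℕ} {hd : 1 ≤ d + 1} {hL : Odd (ℓ + 1) ∧ 1 < ℓ + 1} {b₀ b₁ : ℝ}

/-! ## §5 From the torus block map to the certificate's index-bond block map `bI`, through `Q*♭`: a majorised real operator after the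
flat `Q*` kernel, read in the geometry `geo9K` of index bonds (source block = the bond itself, target block = `bI`) -/

section Reblock

variable (i : KIdx d ℓ hd hL b₀ b₁) {bI : FBondY i → IBondY i}

/-- the flat `Q*` kernel applied to a function of the index bonds, entrywise: `(Q*♭ω)(f) = Σ_y q_y(f)·ω(y)` (`qsK = qKᵀ`, `qK y f = q_y(f)` r03's weight).
[cite: Balaban1984PropagatorsII, (2.18)–(2.20) p.226; Balaban1984PropagatorsI, (1.18) p.20] -/
theorem qsK_mulVec_apply (ω : IBondY i → ℝ) (f : FBondY i) : (qsK i *ᵥ ω) f = ∑ y, qwt i.hN i.D i.hk y f * ω y := by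
  simp only [Matrix.mulVec, dotProduct, qsK_eq_transpose, Matrix.transpose_apply, qK_apply]

/-- `q_y(f) ≤ 1`. [cite: Balaban1984PropagatorsI, (1.18) p.20 (averaging weights)] -/
theorem qwt_le_one (y : IBondY i) (f : FBondY i) : qwt i.hN i.D i.hk y f ≤ 1 := by
  refine (qwt_le i.hN i.D i.hk y f).trans (inv_le_one_of_one_le₀ (one_le_pow₀ (one_le_pow₀ ?_)))
  exact_mod_cast Nat.succ_le_succ (Nat.zero_le ℓ)

/-- a contour bond of `y` (one carrying weight `q_y ≠ 0`) has its block within `ℓ + 3` of the carrier block of `y`. [cite: Balaban1984PropagatorsII, (2.45)–(2.46) p.231] -/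
theorem dist_blkV1_le_of_qwt_ne_zero {y : IBondY i} {f : FBondY i} (hf : qwt i.hN i.D i.hk y f ≠ 0) :
    distB i (β i.hN i.D i.hk y) (blkV1 i.hN i.D f) ≤ (ℓ : ℝ) + 3 :=
  geomT_dist_ends_le i.hN i.D i.hk (one_le_k i) (two_le_RMh i) (one_le_Mh i) (one_le_P i) y (ends_of_qwt_ne_zero i hf)

/-- ★ **A MAJORISED OPERATOR ON A SOURCE SPREAD NEAR ONE BLOCK** (the block decomposition (2.52) summed by Lemma 2.1 (2.61) at a quarter of the rate): if
`T` has the torus block majorant `C·ηᵐL^{mj(y)}·e^{−δd_T(y,y′)}` and `v` is bounded by `B` and vanishes off the blocks within `r` of `y₀`, then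
`|(Tv)(f)| ≤ C·ηᵐL^{mj(f)}·B·c·e^{¾δr}·e^{−¾δ·d_T(y(f), y₀)}`. [cite: Balaban1984PropagatorsII, (2.51)–(2.52) p.232, Lemma 2.1 (2.61) p.234] -/
theorem abs_apply_le_of_near {T : Module.End ℝ (FBondY i → ℝ)} {C δ : ℝ} (hC : 0 ≤ C) (hδ : 0 ≤ δ) (m : ℕ)
    (hT : HasMajorant (g := geomT i.D) (blkV1 i.hN i.D) T
      (fun y y' => C * |i.cf|⁻¹ ^ m * ((ℓ : ℝ) + 1) ^ (m * y.1.1) * Real.exp (-(δ * (geomT i.D).dist y y'))))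
    {c : ℝ} (h261 : Ineq261With c (geomT i.D) δ (1 / 4)) (y₀ : BlkY i) {r B : ℝ} (hB : 0 ≤ B)
    (v : FBondY i → ℝ) (hv : ∀ z, |v z| ≤ B) (hsupp : ∀ z, v z ≠ 0 → distB i y₀ (blkV1 i.hN i.D z) ≤ r) (f : FBondY i) :
    |T v f| ≤ C * |i.cf|⁻¹ ^ m * ((ℓ : ℝ) + 1) ^ (m * (blkV1 i.hN i.D f).1.1) * B * c * Real.exp (3 / 4 * δ * r) *
      Real.exp (-(3 / 4 * δ * distB i (blkV1 i.hN i.D f) y₀)) := by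
  classical
  let U : BlkY i → ℝ := fun y => if distB i y₀ y ≤ r then B else 0
  have hU0 : ∀ y, 0 ≤ U y := fun y => by
    simp only [U]; split_ifs
    · exact hB
    · exact le_rfl
  have hU : ∀ z, |v z| ≤ U (blkV1 i.hN i.D z) := by
    intro z
    by_cases hz : v z = 0
    · rw [hz, abs_zero]; exact hU0 _
    · have hmem := hsupp z hz
      simp only [U, if_pos hmem]
      exact hv z
  refine (abs_le_sum_of_hasMajorant (g := geomT i.D) (blkV1 i.hN i.D) hT v U hU0 hU f).trans ?_
  set bf := blkV1 i.hN i.D f with hbf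
  set w : ℝ := C * |i.cf|⁻¹ ^ m * ((ℓ : ℝ) + 1) ^ (m * bf.1.1) with hw
  have hw0 : 0 ≤ w := by positivity
  have hterm : ∀ y : BlkY i,
      w * Real.exp (-(δ * (geomT i.D).dist bf y)) * U y ≤
        w * B * Real.exp (3 / 4 * δ * r) * Real.exp (-(3 / 4 * δ * distB i bf y₀)) * Real.exp (-(1 / 4 * δ * distB i bf y)) := by
    intro y
    by_cases hy : distB i y₀ y ≤ r
    · simp only [U, if_pos hy]
      have htri : distB i bf y₀ ≤ distB i bf y + r := by
        have t := distB_triangle i bf y y₀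
        have hs : distB i y y₀ = distB i y₀ y := dist_symm_geoBT (toKT i) _ _
        linarith
      have hd0 : 0 ≤ distB i bf y := distB_nonneg i bf y
      have hexp : Real.exp (-(δ * (geomT i.D).dist bf y)) ≤
          Real.exp (3 / 4 * δ * r) * Real.exp (-(3 / 4 * δ * distB i bf y₀)) * Real.exp (-(1 / 4 * δ * distB i bf y)) := by
        rw [← Real.exp_add, ← Real.exp_add]
        refine Real.exp_le_exp.2 ?_
        change -(δ * distB i bf y) ≤ _
        have h34 : 3 / 4 * δ * distB i bf y₀ ≤ 3 / 4 * δ * (distB i bf y + r) := mul_le_mul_of_nonneg_left htri (by positivity)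
        linarith
      calc w * Real.exp (-(δ * (geomT i.D).dist bf y)) * B = w * B * Real.exp (-(δ * (geomT i.D).dist bf y)) := by ring
        _ ≤ w * B * (Real.exp (3 / 4 * δ * r) * Real.exp (-(3 / 4 * δ * distB i bf y₀)) * Real.exp (-(1 / 4 * δ * distB i bf y))) :=
            mul_le_mul_of_nonneg_left hexp (mul_nonneg hw0 hB)
        _ = _ := by ring
    · simp only [U, if_neg hy, mul_zero]
      positivity
  have h261' : ∑ y : BlkY i, Real.exp (-(1 / 4 * δ * distB i bf y)) ≤ c := h261 bf
  have hc0 : 0 ≤ c := le_trans (Finset.sum_nonneg fun y _ => (Real.exp_pos _).le) h261'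
  calc ∑ y : BlkY i, w * Real.exp (-(δ * (geomT i.D).dist bf y)) * U y
      ≤ ∑ y : BlkY i, w * B * Real.exp (3 / 4 * δ * r) * Real.exp (-(3 / 4 * δ * distB i bf y₀)) *
          Real.exp (-(1 / 4 * δ * distB i bf y)) := Finset.sum_le_sum fun y _ => hterm y
    _ = w * B * Real.exp (3 / 4 * δ * r) * Real.exp (-(3 / 4 * δ * distB i bf y₀)) *
          ∑ y : BlkY i, Real.exp (-(1 / 4 * δ * distB i bf y)) := by rw [Finset.mul_sum]
    _ ≤ w * B * Real.exp (3 / 4 * δ * r) * Real.exp (-(3 / 4 * δ * distB i bf y₀)) * c :=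
        mul_le_mul_of_nonneg_left h261' (by positivity)
    _ = _ := by rw [hw]; ring

/-- ★★ **RE-BLOCKING THROUGH `Q*♭`**: a real operator `T` on the fine bonds with the torus block majorant `C·ηᵐL^{mj(y)}·e^{−δd_T(y,y′)}` gives, after the
flat `Q*` kernel, an operator from index-bond functions to fine-bond functions with the majorant `C·c·e^{¾δ(ℓ+4)}·(Lʲη)(a)ᵐ·e^{−¾δ·d(a,a′)}` in the
geometry `geo9K` of the index bonds — source block = the index bond itself, target block = a LEVEL- and 1-FAITHFUL block map `bI` (the certificate's
`hlev ∕ hβ1`).  Print: `supp Q*ω` spreads over the blocks met by the double block of the bond (within `ℓ + 3`), summed by Lemma 2.1 (2.61); `bI` costs one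
more unit of distance. [cite: Balaban1984PropagatorsII, (2.51)–(2.52) p.232, Lemma 2.1 (2.61) p.234, (2.45)–(2.46) p.231; Balaban1985BackgroundPropagators, p.398 (remark after (3.47))] -/
theorem hasMajorantHom_comp_qsK_bI (hlev : ∀ f : FBondY i, lvl i.hN i.D i.hk (bI f) = (blkV1 i.hN i.D f).1.1)
    (hβ1 : ∀ f : FBondY i, (geomT i.D).dist (β i.hN i.D i.hk (bI f)) (blkV1 i.hN i.D f) ≤ 1)
    {T : Module.End ℝ (FBondY i → ℝ)} {C δ : ℝ} (hC : 0 ≤ C) (hδ : 0 ≤ δ) (m : ℕ)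
    (hT : HasMajorant (g := geomT i.D) (blkV1 i.hN i.D) T
      (fun y y' => C * |i.cf|⁻¹ ^ m * ((ℓ : ℝ) + 1) ^ (m * y.1.1) * Real.exp (-(δ * (geomT i.D).dist y y'))))
    {c : ℝ} (h261 : Ineq261With c (geomT i.D) δ (1 / 4)) (R₀ : ℝ) (H₀ : Prop) [Fintype (geo9K i).Site] :
    HasMajorantHom (g := toB6 (geo9K i) R₀ H₀) (fun a : IBondY i => a) bI (T ∘ₗ Matrix.toLin' (qsK i))
      (fun a a' => C * c * Real.exp (3 / 4 * δ * ((ℓ : ℝ) + 4)) * (geo9K i).len a ^ m *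
        Real.exp (-(3 / 4 * δ * (geo9K i).dist a a'))) := by
  intro a' ω Bω hω f
  change IBondY i at a'
  have ha' : ∀ y : IBondY i, y ≠ a' → ω y = 0 := fun y hy => hω.off y hy
  -- the source `Q*♭ω = ω(a′)·q_{a′}(·)`: bounded by `Bω`, supported on the blocks within `ℓ + 3` of the carrier block of `a′`
  have hv : ∀ z, (qsK i *ᵥ ω) z = qwt i.hN i.D i.hk a' z * ω a' := fun z => by
    rw [qsK_mulVec_apply, Finset.sum_eq_single a']
    · intro y _ hy; rw [ha' y hy, mul_zero]
    · intro h; exact absurd (Finset.mem_univ _) h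
  have hvB : ∀ z, |(Matrix.toLin' (qsK i) ω) z| ≤ Bω := fun z => by
    rw [Matrix.toLin'_apply, hv, abs_mul, abs_of_nonneg (qwt_nonneg _ _ _ _ _)]
    calc qwt i.hN i.D i.hk a' z * |ω a'| ≤ 1 * Bω := mul_le_mul (qwt_le_one i a' z) (hω.bound a' rfl) (abs_nonneg _) zero_le_one
      _ = Bω := one_mul _
  have hvS : ∀ z, (Matrix.toLin' (qsK i) ω) z ≠ 0 → distB i (β i.hN i.D i.hk a') (blkV1 i.hN i.D z) ≤ (ℓ : ℝ) + 3 := fun z hz => by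
    rw [Matrix.toLin'_apply, hv] at hz
    exact dist_blkV1_le_of_qwt_ne_zero i (left_ne_zero_of_mul hz)
  have hmain := abs_apply_le_of_near i hC hδ m hT h261 (β i.hN i.D i.hk a') hω.nonneg _ hvB hvS f
  rw [LinearMap.comp_apply]
  refine hmain.trans ?_
  -- re-block the target (`hβ1`: one unit of distance; `hlev`: the same scale)
  set bf := blkV1 i.hN i.D f with hbf
  have htri2 : (geo9K i).dist (bI f) a' ≤ 1 + distB i bf (β i.hN i.D i.hk a') := by
    change distB i (β i.hN i.D i.hk (bI f)) (β i.hN i.D i.hk a') ≤ 1 + distB i bf (β i.hN i.D i.hk a')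
    have h1 : distB i (β i.hN i.D i.hk (bI f)) bf ≤ 1 := hβ1 f
    linarith [distB_triangle i (β i.hN i.D i.hk (bI f)) bf (β i.hN i.D i.hk a')]
  have hexp2 : Real.exp (-(3 / 4 * δ * distB i bf (β i.hN i.D i.hk a'))) ≤
      Real.exp (3 / 4 * δ) * Real.exp (-(3 / 4 * δ * (geo9K i).dist (bI f) a')) := by
    rw [← Real.exp_add]
    refine Real.exp_le_exp.2 ?_
    have := mul_le_mul_of_nonneg_left htri2 (show (0 : ℝ) ≤ 3 / 4 * δ by positivity)
    linarith
  have hlen : |i.cf|⁻¹ ^ m * ((ℓ : ℝ) + 1) ^ (m * bf.1.1) = (geo9K i).len (bI f) ^ m := by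
    rw [B9GeoNormsKLevelV1.geo9K_len_kGeo, B6KLevelCensusIndexV1.len_eq, hlev f, ← hbf, div_eq_mul_inv, mul_pow, ← pow_mul, mul_comm]
    push_cast
    ring
  have hc0 : 0 ≤ c := le_trans (Finset.sum_nonneg fun y _ => (Real.exp_pos _).le) (h261 bf)
  have h0 : 0 ≤ C * |i.cf|⁻¹ ^ m * ((ℓ : ℝ) + 1) ^ (m * bf.1.1) * Bω * c * Real.exp (3 / 4 * δ * ((ℓ : ℝ) + 3)) := by
    have := hω.nonneg; positivity
  calc C * |i.cf|⁻¹ ^ m * ((ℓ : ℝ) + 1) ^ (m * bf.1.1) * Bω * c * Real.exp (3 / 4 * δ * ((ℓ : ℝ) + 3)) *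
        Real.exp (-(3 / 4 * δ * distB i bf (β i.hN i.D i.hk a')))
      ≤ C * |i.cf|⁻¹ ^ m * ((ℓ : ℝ) + 1) ^ (m * bf.1.1) * Bω * c * Real.exp (3 / 4 * δ * ((ℓ : ℝ) + 3)) *
          (Real.exp (3 / 4 * δ) * Real.exp (-(3 / 4 * δ * (geo9K i).dist (bI f) a'))) := mul_le_mul_of_nonneg_left hexp2 h0
    _ = C * c * (Real.exp (3 / 4 * δ * ((ℓ : ℝ) + 3)) * Real.exp (3 / 4 * δ)) * (|i.cf|⁻¹ ^ m * ((ℓ : ℝ) + 1) ^ (m * bf.1.1)) *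
          Real.exp (-(3 / 4 * δ * (geo9K i).dist (bI f) a')) * Bω := by ring
    _ = C * c * Real.exp (3 / 4 * δ * ((ℓ : ℝ) + 4)) * (geo9K i).len (bI f) ^ m *
          Real.exp (-(3 / 4 * δ * (geo9K i).dist (bI f) a')) * Bω := by
        rw [hlen, ← Real.exp_add]; ring_nf

end Reblock

/-! ## §6 AT THE PINS: the `G₀Q*` and `∇G₀Q*` letters of `LettersH` ∕ `Letters313` at a configuration reading `1`, in the state classes -/

section Letters

variable {𝔸 : Type} [NormedRing 𝔸] [NormedAlgebra ℂ 𝔸] [CompleteSpace 𝔸] [FiniteDimensional ℝ 𝔸]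
variable {κ : Type} [Fintype κ]
variable (i : KIdx d ℓ hd hL b₀ b₁) (b : Module.Basis κ ℝ 𝔸) (B : B9.Backgrounds) (cfg : B.Cfg → CfgY 𝔸 i)
  (O : BondOpY 𝔸 i) (parB : BondParY 𝔸 i)

/-- ★ **THE COMPOSITE `G₀Q*` AT THE PINS, AT `U = 1`, IS THE MIXED MODEL OF THE FLAT FAMILY `G ∘ Q*♭`** (the reading constants `c·c⁻¹` cancel): with
`O(1)(J ⊗ E) = (GJ) ⊗ E` and transporters trivial at `1` (`QsY_one`), `GcoK … O U₁ ∘ QscoKH … parB U₁ = coordOpKH b (fun _ => O(1) ∘ Q*(1))`, and that family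
acts on `ω ⊗ E` as `(G(Q*♭ω)) ⊗ E`. [cite: Balaban1985BackgroundPropagators, (3.126) p.420, (3.14)–(3.15) p.393, Cor. 3.5 p.407, dictionary] -/
theorem GcoK_comp_QscoKH_one (hc : cR39 b ≠ 0) {U₁ : B.Cfg} (hU₁ : cfg U₁ = fun _ _ => 1) :
    GcoK i b B cfg O U₁ ∘ₗ QscoKH i b B cfg parB U₁ =
      coordOpKH b (fun _ : Fin (d + 1) => (O (fun _ _ => 1)).restrictScalars ℝ ∘ₗ (QsY i parB (fun _ _ => 1)).restrictScalars ℝ) := by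
  rw [GcoK, QscoKH, hU₁, LinearMap.smul_comp, LinearMap.comp_smul, smul_smul, mul_inv_cancel₀ hc, one_smul, coordOpK_comp_coordOpKH]

omit [FiniteDimensional ℝ 𝔸] [Fintype κ] in
/-- the flat family `O(1) ∘ Q*(1)` acts on product-form inputs as the real operator `G ∘ Q*♭`. [cite: Balaban1985BackgroundPropagators, (3.14)–(3.15) p.393, Cor. 3.5 p.407, dictionary] -/
theorem O_QsY_one_liftY (hparB : ∀ s s', parB (fun _ _ => 1) s s' = 1)
    (hO : ∀ (J : FBondY i → ℝ) (E : 𝔸), O (fun _ _ => 1) (liftY J E) = liftY (Gop i J) E) (ω : IBondY i → ℝ) (E : 𝔸) :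
    ((O (fun _ _ => 1)).restrictScalars ℝ ∘ₗ (QsY i parB (fun _ _ => 1)).restrictScalars ℝ) (liftY ω E) =
      liftY ((Gop i ∘ₗ Matrix.toLin' (qsK i)) ω) E := by
  rw [LinearMap.comp_apply, LinearMap.restrictScalars_apply, LinearMap.restrictScalars_apply, QsY_one i hparB, liftMatY_liftY, hO,
    LinearMap.comp_apply, Matrix.toLin'_apply]

/-- ★ the same for `∇_U G₀ Q*` at `U = 1`: `DcoK ∘ GcoK ∘ QscoKH = coordOpKH b (fun ν => ∇_{1,ν} ∘ O(1) ∘ Q*(1))`, acting on `ω ⊗ E` as `(∇_ν G Q*♭ ω) ⊗ E`.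
[cite: Balaban1985BackgroundPropagators, (3.133) p.422 («∇_U H»), (3.14)–(3.15) p.393, Cor. 3.5 p.407, dictionary] -/
theorem DcoK_GcoK_comp_QscoKH_one (hc : cR39 b ≠ 0) {U₁ : B.Cfg} (hU₁ : cfg U₁ = fun _ _ => 1) :
    DcoK i b B cfg U₁ ∘ₗ GcoK i b B cfg O U₁ ∘ₗ QscoKH i b B cfg parB U₁ =
      coordOpKH b (fun ν : Fin (d + 1) => cdBₗ i (fun _ _ => 1) ν ∘ₗ (O (fun _ _ => 1)).restrictScalars ℝ ∘ₗ
        (QsY i parB (fun _ _ => 1)).restrictScalars ℝ) := by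
  rw [GcoK_comp_QscoKH_one i b B cfg O parB hc hU₁, DcoK, hU₁, coordOpK_comp_coordOpKH]

omit [FiniteDimensional ℝ 𝔸] [Fintype κ] in
/-- the flat family `∇_{1,ν} ∘ O(1) ∘ Q*(1)` acts on product-form inputs as `∇_ν ∘ G ∘ Q*♭` (dag-n06-g's `cdB_one_liftY`). [cite: Balaban1985BackgroundPropagators, (3.133) p.422, Cor. 3.5 p.407, dictionary] -/
theorem cdB_O_QsY_one_liftY (hparB : ∀ s s', parB (fun _ _ => 1) s s' = 1)
    (hO : ∀ (J : FBondY i → ℝ) (E : 𝔸), O (fun _ _ => 1) (liftY J E) = liftY (Gop i J) E) (ν : Fin (d + 1)) (ω : IBondY i → ℝ) (E : 𝔸) :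
    (cdBₗ i (fun _ _ => 1) ν ∘ₗ (O (fun _ _ => 1)).restrictScalars ℝ ∘ₗ (QsY i parB (fun _ _ => 1)).restrictScalars ℝ) (liftY ω E) =
      liftY (((DV ν i.cf ∘ₗ Gop i) ∘ₗ Matrix.toLin' (qsK i)) ω) E := by
  rw [LinearMap.comp_apply, LinearMap.comp_apply, LinearMap.restrictScalars_apply, LinearMap.restrictScalars_apply, QsY_one i hparB,
    liftMatY_liftY, hO, cdBₗ_apply, cdB_one_liftY, LinearMap.comp_apply, LinearMap.comp_apply, Matrix.toLin'_apply]

variable {Y W : Type}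

/-- **rescaling a two-space sup majorant `K₀·(Lʲη)(a)ᵐ·e^{−δd}` into the state classes `𝔠⁽⁰⁾ → 𝔠⁽ᵐ⁾`** (n06-l's `hasMaj_cNorm_of_hasMaj` after
`hasMaj_of_hasMajorantHom`; the power moves into the target size). [cite: Balaban1985BackgroundPropagators, p.398 (remark after (3.47)); Balaban1984PropagatorsII, (2.51) p.232] -/
theorem hasMaj_cNorm_of_hasMajorantHom_pow {g : B9.Geometry} [Fintype g.Site] (hG : B9Thm312Whole.GeoOK g) {V X : Type} [Fintype V] [Fintype X]
    {blkV : V → g.Site} {blk : X → g.Site} {T : (V → ℝ) →ₗ[ℝ] (X → ℝ)} {K₀ δ' : ℝ} (hK₀ : 0 ≤ K₀) (m : ℕ) {R₀ : ℝ} {H₀ : Prop}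
    (h : HasMajorantHom (g := toB6 g R₀ H₀) blkV blk T (fun a a' => K₀ * g.len a ^ m * Real.exp (-(δ' * g.dist a a')))) :
    B11SectG.HasMaj (B9Thm312Whole.cNorm R₀ H₀ blkV hG.lenle 0) (B9Thm312Whole.cNorm R₀ H₀ blk hG.lenle m) T
      (fun a a' => K₀ * Real.exp (-(δ' * g.dist a a'))) := by
  have hK : ∀ a a', 0 ≤ K₀ * g.len a ^ m * Real.exp (-(δ' * g.dist a a')) := fun a a' =>
    mul_nonneg (mul_nonneg hK₀ (pow_nonneg (hG.lenle a) m)) (Real.exp_nonneg _)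
  have h0 := B9Thm37AllNorms.hasMaj_of_hasMajorantHom (G := toB6 g R₀ H₀) blkV blk hK h
  refine (B9Thm312WholeLeaf.hasMaj_cNorm_of_hasMaj hG m 0 h0).mono fun y y' => le_of_eq ?_
  have hy : g.len y ^ m ≠ 0 := pow_ne_zero m (hG.lenpos y).ne'
  simp only [B9Thm312Whole.wt, pow_zero, mul_one]
  calc K₀ * g.len y ^ m * Real.exp (-(δ' * g.dist y y')) * (g.len y ^ m)⁻¹
      = K₀ * Real.exp (-(δ' * g.dist y y')) * (g.len y ^ m * (g.len y ^ m)⁻¹) := by ring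
    _ = K₀ * Real.exp (-(δ' * g.dist y y')) := by rw [mul_inv_cancel₀ hy, mul_one]

/-- ★★★ **THE LETTER `gQs2` OF `LettersH` ∕ `Letters313` AT `U = 1`** — `G₀(1)Q*(1) : 𝔠_Z⁽⁰⁾ → 𝔠⁽²⁾` with the majorant `B₃·e^{−δ₃′d}`, at ANY letter record
`𝔬` over the index-bond geometry whose `G0 ∕ Qstar` at a configuration `U₁` reading `1` are pinned to node00-def-Y's models `GcoK … O ∕ QscoKH … parB` (the
certificate's `hG0co12 ∕ hQsco12`, block maps `hblk12 ∕ hblkZ12`) with `O(1)(J ⊗ E) = (GJ) ⊗ E` (def-Y `GAY_one_liftY`) and transporters trivial at `1`, the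
block map `bI` level- and 1-faithful (`hlev ∕ hβ1`): from the (2.136)₀ torus majorant of `G = Δ_a⁻¹` and (2.61).  Constants: `B₃ = C·c·e^{¾δ₃(ℓ+4)}`,
`δ₃′ = ¾δ₃`. [cite: Balaban1985BackgroundPropagators, (3.126) p.420, (3.132)–(3.133) p.422, Thm 3.3 p.399, Cor. 3.5 p.407; Balaban1984PropagatorsII, Prop. 2.6 (2.136) p.247, Lemma 2.1 (2.61) p.234] -/
theorem hasMaj_G0_Qstar_one (hG : B9Thm312Whole.GeoOK (geo9K i)) [Fintype (geo9K i).Site] [Fintype Y] [Fintype W]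
    (hc : cR39 b ≠ 0) (hparB : ∀ s s', parB (fun _ _ => 1) s s' = 1)
    (hO : ∀ (J : FBondY i → ℝ) (E : 𝔸), O (fun _ _ => 1) (liftY J E) = liftY (Gop i J) E) {U₁ : B.Cfg} (hU₁ : cfg U₁ = fun _ _ => 1)
    {bI : FBondY i → IBondY i} (hlev : ∀ f : FBondY i, lvl i.hN i.D i.hk (bI f) = (blkV1 i.hN i.D f).1.1)
    (hβ1 : ∀ f : FBondY i, (geomT i.D).dist (β i.hN i.D i.hk (bI f)) (blkV1 i.hN i.D f) ≤ 1)
    (𝔬 : B9Thm312Whole.Ops (geo9K i) B (XBK κ i) Y (XHK κ i) W) (hblk : 𝔬.blk = blkBK i bI) (hblkZ : 𝔬.blkZ = blkHK i)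
    (hG0 : 𝔬.G0 U₁ = GcoK i b B cfg O U₁) (hQs : 𝔬.Qstar U₁ = QscoKH i b B cfg parB U₁)
    {C δ c : ℝ} (hC : 0 ≤ C) (hδ : 0 ≤ δ) (hc0 : 0 ≤ c)
    (hT : HasMajorant (g := geomT i.D) (blkV1 i.hN i.D) (Gop i)
      (fun y y' => C * |i.cf|⁻¹ ^ 2 * ((ℓ : ℝ) + 1) ^ (2 * y.1.1) * Real.exp (-(δ * (geomT i.D).dist y y'))))
    (h261 : Ineq261With c (geomT i.D) δ (1 / 4)) {R₀ : ℝ} {H₀ : Prop} :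
    B11SectG.HasMaj (B9Thm312Whole.cNorm R₀ H₀ 𝔬.blkZ hG.lenle 0) (B9Thm312Whole.cNorm R₀ H₀ 𝔬.blk hG.lenle 2) (𝔬.G0 U₁ ∘ₗ 𝔬.Qstar U₁)
      (fun a a' => C * c * Real.exp (3 / 4 * δ * ((ℓ : ℝ) + 4)) * Real.exp (-(3 / 4 * δ * (geo9K i).dist a a'))) := by
  rw [hblk, hblkZ, hG0, hQs, GcoK_comp_QscoKH_one i b B cfg O parB hc hU₁]
  refine hasMaj_cNorm_of_hasMajorantHom_pow hG (by positivity) 2 ?_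
  exact hasMajorantHom_coordOpKH_of_liftY b (G := toB6 (geo9K i) R₀ H₀) (blk' := fun a : IBondY i => a) (blk := bI)
    (T := fun _ => Gop i ∘ₗ Matrix.toLin' (qsK i)) (fun _ ω E => O_QsY_one_liftY i O parB hparB hO ω E)
    fun _ => hasMajorantHom_comp_qsK_bI i hlev hβ1 hC hδ 2 hT h261 R₀ H₀

/-- ★★★ **THE LETTER `dgQs` OF `LettersH` AT `U = 1`** — `∇_U G₀(1)Q*(1) : 𝔠_Z⁽⁰⁾ → 𝔠_Y⁽¹⁾` with the majorant `B₃·e^{−δ₃′d}`, at a letter record pinned as in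
`hasMaj_G0_Qstar_one` plus `D` pinned to `DcoK` (the certificate's `hDco12`, `hblkY12`): from the (2.136)₁ torus majorant of `∇G` and (2.61).
[cite: Balaban1985BackgroundPropagators, (3.133) p.422, Thm 3.3 p.399, (3.42) p.397, Cor. 3.5 p.407; Balaban1984PropagatorsII, Prop. 2.6 (2.136) p.247, Lemma 2.1 (2.61) p.234] -/
theorem hasMaj_D_G0_Qstar_one (hG : B9Thm312Whole.GeoOK (geo9K i)) [Fintype (geo9K i).Site] [Fintype W]
    (hc : cR39 b ≠ 0) (hparB : ∀ s s', parB (fun _ _ => 1) s s' = 1)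
    (hO : ∀ (J : FBondY i → ℝ) (E : 𝔸), O (fun _ _ => 1) (liftY J E) = liftY (Gop i J) E) {U₁ : B.Cfg} (hU₁ : cfg U₁ = fun _ _ => 1)
    {bI : FBondY i → IBondY i} (hlev : ∀ f : FBondY i, lvl i.hN i.D i.hk (bI f) = (blkV1 i.hN i.D f).1.1)
    (hβ1 : ∀ f : FBondY i, (geomT i.D).dist (β i.hN i.D i.hk (bI f)) (blkV1 i.hN i.D f) ≤ 1)
    (𝔬 : B9Thm312Whole.Ops (geo9K i) B (XBK κ i) (XBK κ i) (XHK κ i) W) (hblkY : 𝔬.blkY = blkBK i bI) (hblkZ : 𝔬.blkZ = blkHK i)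
    (hG0 : 𝔬.G0 U₁ = GcoK i b B cfg O U₁) (hQs : 𝔬.Qstar U₁ = QscoKH i b B cfg parB U₁) (hD : 𝔬.D U₁ = DcoK i b B cfg U₁)
    {C δ c : ℝ} (hC : 0 ≤ C) (hδ : 0 ≤ δ) (hc0 : 0 ≤ c)
    (hT : ∀ ν : Fin (d + 1), HasMajorant (g := geomT i.D) (blkV1 i.hN i.D) (DV ν i.cf ∘ₗ Gop i)
      (fun y y' => C * |i.cf|⁻¹ ^ 1 * ((ℓ : ℝ) + 1) ^ (1 * y.1.1) * Real.exp (-(δ * (geomT i.D).dist y y'))))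
    (h261 : Ineq261With c (geomT i.D) δ (1 / 4)) {R₀ : ℝ} {H₀ : Prop} :
    B11SectG.HasMaj (B9Thm312Whole.cNorm R₀ H₀ 𝔬.blkZ hG.lenle 0) (B9Thm312Whole.cNorm R₀ H₀ 𝔬.blkY hG.lenle 1)
      (𝔬.D U₁ ∘ₗ 𝔬.G0 U₁ ∘ₗ 𝔬.Qstar U₁)
      (fun a a' => C * c * Real.exp (3 / 4 * δ * ((ℓ : ℝ) + 4)) * Real.exp (-(3 / 4 * δ * (geo9K i).dist a a'))) := by
  rw [hblkY, hblkZ, hG0, hQs, hD, DcoK_GcoK_comp_QscoKH_one i b B cfg O parB hc hU₁]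
  refine hasMaj_cNorm_of_hasMajorantHom_pow hG (by positivity) 1 ?_
  exact hasMajorantHom_coordOpKH_of_liftY b (G := toB6 (geo9K i) R₀ H₀) (blk' := fun a : IBondY i => a) (blk := bI)
    (T := fun ν => (DV ν i.cf ∘ₗ Gop i) ∘ₗ Matrix.toLin' (qsK i)) (fun ν ω E => cdB_O_QsY_one_liftY i O parB hparB hO ν ω E)
    fun ν => hasMajorantHom_comp_qsK_bI i hlev hβ1 hC hδ 1 (hT ν) h261 R₀ H₀

end Letters


/-! ## §7 UNIFORMLY ON THE CENSUS: one threshold, one constant, one rate for every member and every such letter record (N03's constants) -/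

section Record

variable {𝔸 : Type} [NormedRing 𝔸] [NormedAlgebra ℂ 𝔸] [CompleteSpace 𝔸] [FiniteDimensional ℝ 𝔸]
variable {κ : Type} [Fintype κ]

/-- ★★★ **THE `G₀Q*`- AND `∇G₀Q*`-LETTERS OF `LettersH` (`gQs2`, `dgQs`) ∕ `Letters313` (`gQs2`) AT `U = 1`, UNIFORMLY ON THE k-LEVEL CENSUS** — the `U = 1`
inhabitants of two of the four fields of the N06 certificate's displayed `hlettersH12` body: for the band `0 < b₀ ≤ b₁` there are `M₁, B₃, δ₃ > 0` (N03's
Prop. 2.6 constants, Lemma 2.1's row sum, `e^{¾δ(ℓ+4)}`) such that for every index `i` with `M ≥ M₁` and every letter record `𝔬` over `geo9K i` with carriers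
`XBK ∕ XBK ∕ XHK`, pinned at a configuration `U₁` reading `1` to `GcoK … O ∕ QscoKH … parB ∕ DcoK` (`O(1)(J ⊗ E) = (GJ) ⊗ E`, transporters trivial at `1`,
`cR39 b ≠ 0`), block maps `blkBK bI ∕ blkBK bI ∕ blkHK` with `bI` level- and 1-faithful:
`G₀(1)Q*(1) : 𝔠_Z⁽⁰⁾ → 𝔠⁽²⁾` and `∇_U G₀(1)Q*(1) : 𝔠_Z⁽⁰⁾ → 𝔠_Y⁽¹⁾` with the majorant `B₃·e^{−δ₃d}`.
[cite: Balaban1985BackgroundPropagators, (3.126) p.420, (3.132)–(3.133) p.422, Thm 3.3 p.399, Cor. 3.5 p.407; Balaban1984PropagatorsII, Prop. 2.6 (2.136) p.247, Lemma 2.1 (2.60)–(2.61) p.234] -/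
theorem lettersH_G0_one_kIdx (hb₀ : 0 < b₀) (hb₁ : b₀ ≤ b₁) : ∃ M₁ B₃ δ₃ : ℝ, 0 < M₁ ∧ 0 < B₃ ∧ 0 < δ₃ ∧
    ∀ i : KIdx d ℓ hd hL b₀ b₁, M₁ ≤ (geo9K i).M → ∀ (hG : B9Thm312Whole.GeoOK (geo9K i)) [Fintype (geo9K i).Site] {W : Type} [Fintype W]
      (b : Module.Basis κ ℝ 𝔸), cR39 b ≠ 0 → ∀ (B : B9.Backgrounds) (cfg : B.Cfg → CfgY 𝔸 i) (O : BondOpY 𝔸 i) (parB : BondParY 𝔸 i),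
      (∀ s s', parB (fun _ _ => 1) s s' = 1) → (∀ (J : FBondY i → ℝ) (E : 𝔸), O (fun _ _ => 1) (liftY J E) = liftY (Gop i J) E) →
      ∀ {U₁ : B.Cfg}, cfg U₁ = (fun _ _ => 1) → ∀ {bI : FBondY i → IBondY i},
      (∀ f : FBondY i, lvl i.hN i.D i.hk (bI f) = (blkV1 i.hN i.D f).1.1) →
      (∀ f : FBondY i, (geomT i.D).dist (β i.hN i.D i.hk (bI f)) (blkV1 i.hN i.D f) ≤ 1) →
      ∀ (𝔬 : B9Thm312Whole.Ops (geo9K i) B (XBK κ i) (XBK κ i) (XHK κ i) W),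
      𝔬.blk = blkBK i bI → 𝔬.blkY = blkBK i bI → 𝔬.blkZ = blkHK i →
      𝔬.G0 U₁ = GcoK i b B cfg O U₁ → 𝔬.Qstar U₁ = QscoKH i b B cfg parB U₁ → 𝔬.D U₁ = DcoK i b B cfg U₁ →
      ∀ {R₀ : ℝ} {H₀ : Prop},
        B11SectG.HasMaj (B9Thm312Whole.cNorm R₀ H₀ 𝔬.blkZ hG.lenle 0) (B9Thm312Whole.cNorm R₀ H₀ 𝔬.blk hG.lenle 2)
          (𝔬.G0 U₁ ∘ₗ 𝔬.Qstar U₁) (fun a a' => B₃ * Real.exp (-(δ₃ * (geo9K i).dist a a'))) ∧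
        B11SectG.HasMaj (B9Thm312Whole.cNorm R₀ H₀ 𝔬.blkZ hG.lenle 0) (B9Thm312Whole.cNorm R₀ H₀ 𝔬.blkY hG.lenle 1)
          (𝔬.D U₁ ∘ₗ 𝔬.G0 U₁ ∘ₗ 𝔬.Qstar U₁) (fun a a' => B₃ * Real.exp (-(δ₃ * (geo9K i).dist a a'))) := by
  obtain ⟨M₁, δ₃, C, hM₁, hδ₃, hC, H⟩ := hasMajorant_Gop_kIdx (d := d) (ℓ := ℓ) (hd := hd) (hL := hL) hb₀ hb₁
  obtain ⟨N, c, -, hc0, hcon⟩ := consts_260_261 d ℓ hδ₃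
  refine ⟨max M₁ ((N : ℝ) + 1), C * (c + 1) * Real.exp (3 / 4 * δ₃ * ((ℓ : ℝ) + 4)), 3 / 4 * δ₃, lt_max_of_lt_left hM₁, by positivity,
    by positivity, ?_⟩
  intro i hM hG _ W _ b hc B cfg O parB hparB hO U₁ hU₁ bI hlev hβ1 𝔬 hblk hblkY hblkZ hG0 hQs hD R₀ H₀
  have hLcast : (((ℓ + 1 : ℕ) : ℝ)) = (ℓ : ℝ) + 1 := by push_cast; ring
  have hMdef : (geo9K i).M = (((ℓ + 1 : ℕ) : ℝ)) * (i.Mh : ℝ) := rfl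
  have hM₁ : M₁ ≤ (kGeoG i).M := (le_max_left _ _).trans hM
  have hN : (N : ℝ) + 1 ≤ ((ℓ : ℝ) + 1) * i.Mh := by rw [← hLcast, ← hMdef]; exact (le_max_right _ _).trans hM
  have hR1 : 1 ≤ i.R := le_trans (by omega) (toKT i).hR
  have hRN : N + 1 ≤ i.R * ((ℓ + 1) * i.Mh) := by
    have h2 : N + 1 ≤ (ℓ + 1) * i.Mh := by exact_mod_cast hN
    calc N + 1 ≤ 1 * ((ℓ + 1) * i.Mh) := by rw [one_mul]; exact h2
      _ ≤ i.R * ((ℓ + 1) * i.Mh) := Nat.mul_le_mul_right _ hR1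
  obtain ⟨-, h261⟩ := hcon i.k i.Mh i.R i.P' (one_le_Mh i) (toKT i).hP hRN
  have h261D : Ineq261With c (geomT i.D) δ₃ (1 / 4) := h261 i.D
  obtain ⟨h0, h1, -, -⟩ := H i hM₁
  have hmono : ∀ a a' : (geo9K i).Site,
      C * c * Real.exp (3 / 4 * δ₃ * ((ℓ : ℝ) + 4)) * Real.exp (-(3 / 4 * δ₃ * (geo9K i).dist a a')) ≤
        C * (c + 1) * Real.exp (3 / 4 * δ₃ * ((ℓ : ℝ) + 4)) * Real.exp (-(3 / 4 * δ₃ * (geo9K i).dist a a')) := fun a a' => by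
    gcongr; linarith
  have hA := hasMaj_G0_Qstar_one (Y := XBK κ i) (W := W) (R₀ := R₀) (H₀ := H₀) i b B cfg O parB hG hc hparB hO hU₁ hlev hβ1 𝔬 hblk hblkZ
    hG0 hQs hC.le hδ₃.le hc0 h0 h261D
  have hB := hasMaj_D_G0_Qstar_one (W := W) (R₀ := R₀) (H₀ := H₀) i b B cfg O parB hG hc hparB hO hU₁ hlev hβ1 𝔬 hblkY hblkZ hG0 hQs hD
    hC.le hδ₃.le hc0 h1 h261D
  exact ⟨hA.mono hmono, hB.mono hmono⟩

end Record

end Literature.MathematicalPhysics.QuantumFieldTheory.Balaban1983to89.B9LettersHAtOneG0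

end
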